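import Mathlib.Geometry.Manifold.ContMDiff.Defs
import Mathlib.Topology.OpenPartialHomeomorph.Constructions
import HarnessLib

/-!
# The disjoint union of a family of partial homeomorphisms with disjoint sources and targets

Topic `Literature/Topology/FourManifolds` (generic helper). Mathlib has the disjoint union
`OpenPartialHomeomorph.disjointUnion e e'` of TWO partial homeomorphisms with disjoint sources
and disjoint targets; here is the version for an arbitrary family `e : ι → OpenPartialHomeomorph X Y`
with pairwise disjoint sources and pairwise disjoint targets, together with the transfer of
smoothness (`ContMDiffOn`) from the members to the union. Written for the tube-swap gluing of
Akbulut–Ruberman (2016), Lemma 2.3 (one gluing map per component of the link; fact seat of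
`Literature.Barriers.SmoothPoincare4.akbulutRuberman2016_symmetryKillingCobordism`), where the
gluing partial diffeomorphism of `GluingConstruction.lean` must be a single
`OpenPartialHomeomorph`.

* `OpenPartialHomeomorph.iUnionOfDisjoint e hs ht` — source `⋃ i, (e i).source`, target
  `⋃ i, (e i).target`, equal to `e i` on `(e i).source` (`iUnionOfDisjoint_apply_of_mem`) and to
  `(e i).symm` on `(e i).target` (`iUnionOfDisjoint_symm_apply_of_mem`);
* `contMDiffOn_iUnionOfDisjoint`, `contMDiffOn_iUnionOfDisjoint_symm`.

Everything here is proved; no named facts are introduced. The three declarations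
`OpenPartialHomeomorph.iUnionOfDisjoint`, `…_source`, `…_target`, `…_apply_of_mem`,
`…_symm_apply_of_mem` are DELIBERATE dot-notation extensions of Mathlib's `OpenPartialHomeomorph`
(companions of Mathlib's `OpenPartialHomeomorph.disjointUnion`), declared with absolute names from
the path namespace; the helpers live in `Literature.Topology.FourManifolds`. [folklore]
-/

open Set Function
open scoped Manifold ContDiff
open scoped _root_.Topology

noncomputable section

namespace Literature.Topology.FourManifolds

variable {X Y : Type*} [TopologicalSpace X] [TopologicalSpace Y] {ι : Type*} [Nonempty ι]
  (e : ι → OpenPartialHomeomorph X Y)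
  (hs : Pairwise (Disjoint on fun i => (e i).source))
  (ht : Pairwise (Disjoint on fun i => (e i).target))

/-- The index of the member whose source contains `x` (junk if none). [folklore] -/
def srcIdx (x : X) : ι := by
  classical
  exact if h : ∃ i, x ∈ (e i).source then h.choose else Classical.arbitrary ι

/-- The index of the member whose target contains `y` (junk if none). [folklore] -/
def tgtIdx (y : Y) : ι := by
  classical
  exact if h : ∃ i, y ∈ (e i).target then h.choose else Classical.arbitrary ι

include hs in
/-- With disjoint sources, the source index of a point of `(e i).source` is `i`. [folklore] -/
theorem srcIdx_eq {x : X} {i : ι} (hx : x ∈ (e i).source) : srcIdx e x = i := by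
  classical
  have h : ∃ j, x ∈ (e j).source := ⟨i, hx⟩
  rw [srcIdx, dif_pos h]
  by_contra hne
  exact Set.disjoint_left.1 (hs hne) h.choose_spec hx

include ht in
/-- With disjoint targets, the target index of a point of `(e i).target` is `i`. [folklore] -/
theorem tgtIdx_eq {y : Y} {i : ι} (hy : y ∈ (e i).target) : tgtIdx e y = i := by
  classical
  have h : ∃ j, y ∈ (e j).target := ⟨i, hy⟩
  rw [tgtIdx, dif_pos h]
  by_contra hne
  exact Set.disjoint_left.1 (ht hne) h.choose_spec hy

/-- **The disjoint union of a family of partial homeomorphisms** with pairwise disjoint sources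
and pairwise disjoint targets. [folklore] -/
def _root_.OpenPartialHomeomorph.iUnionOfDisjoint : OpenPartialHomeomorph X Y where
  toFun x := e (srcIdx e x) x
  invFun y := (e (tgtIdx e y)).symm y
  source := ⋃ i, (e i).source
  target := ⋃ i, (e i).target
  map_source' := by
    intro x hx
    obtain ⟨i, hi⟩ := mem_iUnion.1 hx
    rw [srcIdx_eq e hs hi]
    exact mem_iUnion.2 ⟨i, (e i).map_source hi⟩
  map_target' := by
    intro y hy
    obtain ⟨i, hi⟩ := mem_iUnion.1 hy
    rw [tgtIdx_eq e ht hi]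
    exact mem_iUnion.2 ⟨i, (e i).map_target hi⟩
  left_inv' := by
    intro x hx
    obtain ⟨i, hi⟩ := mem_iUnion.1 hx
    rw [srcIdx_eq e hs hi, tgtIdx_eq e ht ((e i).map_source hi)]
    exact (e i).left_inv hi
  right_inv' := by
    intro y hy
    obtain ⟨i, hi⟩ := mem_iUnion.1 hy
    rw [tgtIdx_eq e ht hi, srcIdx_eq e hs ((e i).map_target hi)]
    exact (e i).right_inv hi
  open_source := isOpen_iUnion fun i => (e i).open_source
  open_target := isOpen_iUnion fun i => (e i).open_target
  continuousOn_toFun := by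
    intro x hx
    obtain ⟨i, hi⟩ := mem_iUnion.1 hx
    have hev : (fun x => e (srcIdx e x) x) =ᶠ[𝓝 x] e i := by
      filter_upwards [(e i).open_source.mem_nhds hi] with x' hx'
      rw [srcIdx_eq e hs hx']
    exact (((e i).continuousAt hi).congr hev.symm).continuousWithinAt
  continuousOn_invFun := by
    intro y hy
    obtain ⟨i, hi⟩ := mem_iUnion.1 hy
    have hev : (fun y => (e (tgtIdx e y)).symm y) =ᶠ[𝓝 y] (e i).symm := by
      filter_upwards [(e i).open_target.mem_nhds hi] with y' hy'
      rw [tgtIdx_eq e ht hy']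
    exact (((e i).continuousAt_symm hi).congr hev.symm).continuousWithinAt

/-- The source of the disjoint union (definitional). [folklore] -/
@[simp] theorem _root_.OpenPartialHomeomorph.iUnionOfDisjoint_source :
    (OpenPartialHomeomorph.iUnionOfDisjoint e hs ht).source = ⋃ i, (e i).source :=
  rfl

/-- The target of the disjoint union (definitional). [folklore] -/
@[simp] theorem _root_.OpenPartialHomeomorph.iUnionOfDisjoint_target :
    (OpenPartialHomeomorph.iUnionOfDisjoint e hs ht).target = ⋃ i, (e i).target :=
  rfl

/-- **On `(e i).source` the disjoint union is `e i`.** [folklore] -/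
theorem _root_.OpenPartialHomeomorph.iUnionOfDisjoint_apply_of_mem {x : X} {i : ι}
    (hx : x ∈ (e i).source) : OpenPartialHomeomorph.iUnionOfDisjoint e hs ht x = e i x := by
  show e (srcIdx e x) x = e i x
  rw [srcIdx_eq e hs hx]

/-- **On `(e i).target` the inverse of the disjoint union is `(e i).symm`.** [folklore] -/
theorem _root_.OpenPartialHomeomorph.iUnionOfDisjoint_symm_apply_of_mem {y : Y} {i : ι}
    (hy : y ∈ (e i).target) :
    (OpenPartialHomeomorph.iUnionOfDisjoint e hs ht).symm y = (e i).symm y := by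
  show (e (tgtIdx e y)).symm y = (e i).symm y
  rw [tgtIdx_eq e ht hy]

/-- The sources of the members lie in the source of the union. [folklore] -/
theorem source_subset_iUnionOfDisjoint_source (i : ι) :
    (e i).source ⊆ (OpenPartialHomeomorph.iUnionOfDisjoint e hs ht).source :=
  subset_iUnion (fun i => (e i).source) i

/-- The targets of the members lie in the target of the union. [folklore] -/
theorem target_subset_iUnionOfDisjoint_target (i : ι) :
    (e i).target ⊆ (OpenPartialHomeomorph.iUnionOfDisjoint e hs ht).target :=
  subset_iUnion (fun i => (e i).target) i

section Smooth

variable {EX HX EY HY : Type*} [NormedAddCommGroup EX] [NormedSpace ℝ EX] [TopologicalSpace HX]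
  [NormedAddCommGroup EY] [NormedSpace ℝ EY] [TopologicalSpace HY]
  {I : ModelWithCorners ℝ EX HX} {J : ModelWithCorners ℝ EY HY}
  [ChartedSpace HX X] [ChartedSpace HY Y] {n : WithTop ℕ∞}

/-- **Smoothness of the disjoint union** from smoothness of the members on their sources.
[folklore] -/
theorem contMDiffOn_iUnionOfDisjoint (h : ∀ i, ContMDiffOn I J n (e i) (e i).source) :
    ContMDiffOn I J n (OpenPartialHomeomorph.iUnionOfDisjoint e hs ht)
      (OpenPartialHomeomorph.iUnionOfDisjoint e hs ht).source := by
  intro x hx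
  obtain ⟨i, hi⟩ := mem_iUnion.1 hx
  have hev : (OpenPartialHomeomorph.iUnionOfDisjoint e hs ht : X → Y) =ᶠ[𝓝 x] e i := by
    filter_upwards [(e i).open_source.mem_nhds hi] with x' hx'
    exact OpenPartialHomeomorph.iUnionOfDisjoint_apply_of_mem e hs ht hx'
  exact (((h i).contMDiffAt ((e i).open_source.mem_nhds hi)).congr_of_eventuallyEq
    hev).contMDiffWithinAt

/-- **Smoothness of the inverse of the disjoint union** from smoothness of the inverses of the
members on their targets. [folklore] -/
theorem contMDiffOn_iUnionOfDisjoint_symm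
    (h : ∀ i, ContMDiffOn J I n (e i).symm (e i).target) :
    ContMDiffOn J I n (OpenPartialHomeomorph.iUnionOfDisjoint e hs ht).symm
      (OpenPartialHomeomorph.iUnionOfDisjoint e hs ht).target := by
  intro y hy
  obtain ⟨i, hi⟩ := mem_iUnion.1 hy
  have hev : ((OpenPartialHomeomorph.iUnionOfDisjoint e hs ht).symm : Y → X) =ᶠ[𝓝 y]
      (e i).symm := by
    filter_upwards [(e i).open_target.mem_nhds hi] with y' hy'
    exact OpenPartialHomeomorph.iUnionOfDisjoint_symm_apply_of_mem e hs ht hy'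
  exact (((h i).contMDiffAt ((e i).open_target.mem_nhds hi)).congr_of_eventuallyEq
    hev).contMDiffWithinAt

end Smooth

end Literature.Topology.FourManifolds

end
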